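import Mathlib
import HarnessLib

/-!
# Tate–Sen: `H⁰(G_F, ℂ_p(η)) = 0` for a character `η` with infinite image on inertia, `F = ℚ_p(μ_m)`

One NAMED FACT (a `def … : Prop`, nothing asserted), the character case of the Tate–Sen theorem in its
PRINTED shape:

**Theorem** (Tate 1967, §3.3 Thm 2; Brinon–Conrad, Thm 2.2.7). Let `K` be a `p`-adic field and
`η : G_K → ℤ_p^×` a continuous character such that `η(I_K)` is infinite. Then
`H^i_cont(G_K, ℂ_K(η)) = 0` for `i = 0, 1`.

We state the `i = 0` half for the UNRAMIFIED local fields `K = F = ℚ_p(μ_m)`, `p ∤ m`, inside a fixed algebraic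
closure: `G_F = {τ ∈ Gal(ℚ̄_p/ℚ_p) | τ fixes every m-th root of unity}` (Mathlib's `PadicAlgCl p`, the Krull
topology on `PadicAlgCl p ≃ₐ[ℚ_[p]] PadicAlgCl p`), acting on `ℂ_p = ℂ_[p]` through continuous ring endomorphisms
`T τ` extending the `τ` (these exist and are unique; the statement quantifies over any such family), the inertia
group `I = {τ | τ fixes every root of unity of order prime to p} ⊆ G_F`, and a `ℤ_p`-valued map `η` that is
multiplicative and continuous ON `G_F` with values of norm `1` there (i.e. a continuous character
`G_F → ℤ_p^×`). Conclusion: a vector `x ∈ ℂ_p` with `T τ x = η(τ) · x` for all `τ ∈ G_F` is zero.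

This is the `n = 1` (character) case of Sen's finiteness theorem, recorded in the tree as the named fact
`Literature.NumberTheory.PAdicHodge.SenFiniteness` (`SenOperator.lean`; there over an abstract local field `F` with
the tree's `absoluteGaloisGroup F` ∕ `CompletedAlgClosure F`); the present `ℚ̄_p`-internal phrasing is the one
consumed by the anticyclotomic-descent files of `Summits/BirchSwinnertonDyer/Rank1Residual/X11b/`
(`PadicSemiInvariant.lean`, `Three/HsiehDescentInertia.lean`), whose cyclotomic special case
(`η = χ_cyc^j`) is the tree THEOREM `Literature.NumberTheory.PAdicHodge.TateTwistInvariants`. Deriving this fact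
from `SenFiniteness` needs transport glue between the two set-ups for `F = ℚ_p(μ_m)` that the tree has only for
`F = ℚ_p` — deliberately NOT done here.

What is NOT here: the `H¹` half; general `p`-adic fields `K`; any proof.

## References
* J. Tate, *p-divisible groups*, Proc. Conf. Local Fields (Driebergen 1966), Springer 1967, §3.3, Theorems 1–2.
  [Tate1967]
* O. Brinon, B. Conrad, *CMI Summer School notes on p-adic Hodge theory* (2009), Theorem 2.2.7. [BrinonConrad2009]
-/

namespace Literature.NumberTheory.PAdicHodge

/-- **Tate–Sen vanishing `H⁰(G_F, ℂ_p(η)) = 0` for `F = ℚ_p(μ_m)` and a character `η` with infinite image on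
inertia** (Tate 1967 §3.3 Thm 2; Brinon–Conrad Thm 2.2.7, verbatim: «if `η : G_K → O_K^×` is a continuous character
such that `η(G_K)` is a commutative p-adic Lie group of dimension at most 1 (i.e., `η(G_K)` is finite or contains
`ℤ_p` as an open subgroup) and if `ℂ_K(η)` denotes `ℂ_K` with the twisted `G_K`-action `g.c = η(g)g(c)` then
`H^i_cont(G_K, ℂ_K(η)) = 0` for `i = 0, 1` when `η(I_K)` is infinite» — here `K = ℚ_p(μ_m)`, `i = 0`, and `η` valued
in `ℤ_p^× ⊂ O_K^×`, whose image is a closed subgroup of `ℤ_p^×` and hence such a Lie group automatically).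
For `0 < m`, `p ∤ m`: let `G_F = {τ | τ ζ = ζ for all ζ ∈ ℚ̄_p with ζ^m = 1}`, let `T τ : ℂ_p →+* ℂ_p` be
continuous extensions of the `τ`, and let `η : Gal(ℚ̄_p/ℚ_p) → ℤ_p` be multiplicative and continuous on `G_F`
with `‖η τ‖ = 1` on `G_F`, such that `η` takes infinitely many values on the inertia group
`{τ | τ fixes every root of unity of order prime to p}`. Then every `x : ℂ_p` with
`T τ x = η(τ) · x` for all `τ ∈ G_F` is `0`. A `Prop`, NOT asserted (named fact); the character case of
`SenFiniteness`. -- TODO(general form): arbitrary p-adic fields `K ⊂ ℚ̄_p` and the `H¹` statement.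
[cite: Tate1967, §3.3 Thm. 2] [cite: BrinonConrad2009, Thm. 2.2.7] -/
def TateSenCharacterVanishing (p : ℕ) [Fact p.Prime] : Prop :=
  ∀ m : ℕ, 0 < m → ¬ p ∣ m →
  ∀ (T : (PadicAlgCl p ≃ₐ[ℚ_[p]] PadicAlgCl p) → ℂ_[p] →+* ℂ_[p]),
    (∀ τ, Continuous (T τ)) → (∀ τ (x : PadicAlgCl p), T τ x = τ x) →
    ∀ η : (PadicAlgCl p ≃ₐ[ℚ_[p]] PadicAlgCl p) → ℤ_[p],
      (∀ τ₁ τ₂, (∀ ζ : PadicAlgCl p, ζ ^ m = 1 → τ₁ ζ = ζ) → (∀ ζ : PadicAlgCl p, ζ ^ m = 1 → τ₂ ζ = ζ) →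
        η (τ₁ * τ₂) = η τ₁ * η τ₂) →
      ContinuousOn η {τ | ∀ ζ : PadicAlgCl p, ζ ^ m = 1 → τ ζ = ζ} →
      (∀ τ, (∀ ζ : PadicAlgCl p, ζ ^ m = 1 → τ ζ = ζ) → ‖η τ‖ = 1) →
      (η '' {τ | ∀ ζ : PadicAlgCl p, (∃ k : ℕ, 0 < k ∧ ¬ p ∣ k ∧ ζ ^ k = 1) → τ ζ = ζ}).Infinite →
      ∀ x : ℂ_[p], (∀ τ, (∀ ζ : PadicAlgCl p, ζ ^ m = 1 → τ ζ = ζ) →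
        T τ x = algebraMap ℚ_[p] ℂ_[p] ((η τ : ℤ_[p]) : ℚ_[p]) * x) → x = 0


/-! ### The inertia form: the same printed theorem for the p-adic field `K = 𝐐̂_p^un` (completed maximal unramified
extension), whose absolute Galois group is the inertia group of `ℚ_p` -/

/-- **Tate–Sen vanishing `H⁰(I, ℂ_p(η)) = 0` for the INERTIA group `I ⊂ Gal(ℚ̄_p/ℚ_p)` and a character `η` OF `I`
with infinite image** — Brinon–Conrad, Thm. 2.2.7 (= Thm. 14.3.4): «Let `K` be a p-adic field and `η : G_K → O_K^×` a
continuous character such that `η(G_K)` is a p-adic Lie group of dimension at most 1. If `η(I_K)` is infinite then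
`H^i_cont(G_K, ℂ_K(η)) = 0` for `i = 0, 1`», where «a p-adic field is a field `K` of characteristic `0` that is
complete with respect to a fixed discrete valuation that has a perfect residue field `k` of characteristic `p > 0`»
(Def. 1.3.1), applied — as the authors themselves do (proof of Prop. 9.1.6, p. 131: «`I_K = G_{K̂^un}`, and replacing
`K` with `K̂^un` … so again using Theorem 2.2.7») — to the p-adic field `K := \widehat{ℚ_p^{un}}` (Exercise 1.4.4 (3): «`K̂^un` is naturally a p-adic field with residue field … an algebraic closure of `k`», and «`I_K := G_{K^un}` is naturally isomorphic to `G_{K̂^un}`» by Krasner’s lemma):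
here `G_K = I_K` is the inertia group `I = Gal(ℚ̄_p/ℚ_p^{un}) = {τ | τ fixes every root of unity of order prime to p}`
of `ℚ_p` (`ℚ_p^{un} = ⋃_{p ∤ k} ℚ_p(μ_k)`; `ℚ̄_p ∩ K = ℚ_p^{un}`, `K̄ = K·ℚ̄_p`), `ℂ_K = ℂ_p`, and a continuous
character `η : I → ℤ_p^× ⊂ O_K^×` has image a closed subgroup of `ℤ_p^×`, a p-adic Lie group of dimension `≤ 1`.
In the `ℚ̄_p`-internal phrasing of `TateSenCharacterVanishing` (Mathlib's `PadicAlgCl p`, Krull topology on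
`PadicAlgCl p ≃ₐ[ℚ_[p]] PadicAlgCl p`, `ℂ_p = ℂ_[p]`): `I` acts on `ℂ_p` through continuous ring endomorphisms
`T τ` extending the `τ` (these exist and are unique; the statement quantifies over any such family), `η` is a
`ℤ_p`-valued map on `Gal(ℚ̄_p/ℚ_p)` that is multiplicative and continuous ON `I` with values of norm `1` there
(a continuous character `I → ℤ_p^×`) and takes infinitely many values on `I`; conclusion: every `x : ℂ_p` with
`T τ x = η(τ) · x` for all `τ ∈ I` is `0` (`x` lies in `ℂ_K(η⁻¹)^{G_K}`, and `η⁻¹(I_K) = η(I)⁻¹` is infinite).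
The `i = 0` half only. STRONGER than `TateSenCharacterVanishing p` (the case `K = ℚ_p(μ_m)`: a semi-invariant for a
character of `G_{ℚ_p(μ_m)} ⊇ I` is one for its restriction to `I` — theorem
`Summit.BirchSwinnertonDyer.BirchSwinnertonDyer.Theorems.tateSenCharacterVanishing_of_inertia`), and the shape the anticyclotomic descent at `p ∥ N` actually consumes (exactness is available on inertia
only: `Summits/BirchSwinnertonDyer/Rank1Residual/X11b/Three/LocalExactnessOfDescent.lean`). A `Prop`, NOT asserted
(named fact). Not derivable in the tree from the cyclotomic theorem `TateTwistInvariants` or from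
`Summits/…/X11b/PadicSemiInvariant.lean` (a character of `I` need not extend to `Gal(ℚ̄_p/ℚ_p)`, nor factor through the
cyclotomic character); its proof runs Tate's normalised traces in the (in general non-cyclotomic) `ℤ_p`-tower over
`K̂^un` cut out by `η` (BC §14). -- TODO(general form): arbitrary p-adic fields `K ⊂ ℂ_p` and the `H¹` statement.
[cite: Tate1967, §3.3 Thm. 2] [cite: BrinonConrad2009, Thm. 2.2.7 (= Thm. 14.3.4), with Def. 1.3.1 and Exercise 1.4.4 (3)] -/
def TateSenInertiaVanishing (p : ℕ) [Fact p.Prime] : Prop :=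
  ∀ (T : (PadicAlgCl p ≃ₐ[ℚ_[p]] PadicAlgCl p) → ℂ_[p] →+* ℂ_[p]),
    (∀ τ, Continuous (T τ)) → (∀ τ (x : PadicAlgCl p), T τ x = τ x) →
    ∀ η : (PadicAlgCl p ≃ₐ[ℚ_[p]] PadicAlgCl p) → ℤ_[p],
      (∀ τ₁ τ₂, (∀ ζ : PadicAlgCl p, (∃ k : ℕ, 0 < k ∧ ¬ p ∣ k ∧ ζ ^ k = 1) → τ₁ ζ = ζ) →
        (∀ ζ : PadicAlgCl p, (∃ k : ℕ, 0 < k ∧ ¬ p ∣ k ∧ ζ ^ k = 1) → τ₂ ζ = ζ) →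
        η (τ₁ * τ₂) = η τ₁ * η τ₂) →
      ContinuousOn η {τ | ∀ ζ : PadicAlgCl p, (∃ k : ℕ, 0 < k ∧ ¬ p ∣ k ∧ ζ ^ k = 1) → τ ζ = ζ} →
      (∀ τ, (∀ ζ : PadicAlgCl p, (∃ k : ℕ, 0 < k ∧ ¬ p ∣ k ∧ ζ ^ k = 1) → τ ζ = ζ) → ‖η τ‖ = 1) →
      (η '' {τ | ∀ ζ : PadicAlgCl p, (∃ k : ℕ, 0 < k ∧ ¬ p ∣ k ∧ ζ ^ k = 1) → τ ζ = ζ}).Infinite →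
      ∀ x : ℂ_[p], (∀ τ, (∀ ζ : PadicAlgCl p, (∃ k : ℕ, 0 < k ∧ ¬ p ∣ k ∧ ζ ^ k = 1) → τ ζ = ζ) →
        T τ x = algebraMap ℚ_[p] ℂ_[p] ((η τ : ℤ_[p]) : ℚ_[p]) * x) → x = 0

end Literature.NumberTheory.PAdicHodge
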